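import Summits.BirchSwinnertonDyer.Rank1Residual.X11b.AnticyclotomicSelmerDual
import Literature.NumberTheory.EllipticCurves.IwasawaEulerCharProofs
import Literature.NumberTheory.EllipticCurves.IwasawaAlgebraStructureProofs
import HarnessLib

/-!
# Route `SchneiderFreeAdditiveX3` (rung K1 door), crux `GordTwoBranchIMC` (item stmt-BirchSwinnertonDyer-19177):
# LATTICE TRANSPORT of the door direction — `μ = 0` makes `Ch_Λ(X') ⊆ Ch_Λ(X)` survive every
# `Λ`-map with `p`-power-killed kernel and cokernel

Cell `bsd-schneider-ideate`, seat `bsd-schneider-door-c3` (prover, generation 4). HONEST FRAMING: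
Iwasawa-ALGEBRA lemmas (kernel-checked, unconditional) plus their reading on the crux's objects;
NOTHING is asserted about elliptic curves, BSD is not advanced, and the crux `GordTwoBranchIMC`
(Keller–Yin arXiv:2410.23241 Thm. 3.5.1 at the frame — PREPRINT) stays OPEN. `--supports` material
for item 19177.

WHY (the recorded risk «lattice/isogeny choice `φ|_{G_p} ≠ 𝟙`» of the crux). Keller–Yin prove
`Char_Λ(𝔛)Λ^{ur} = (𝓛_ε)` (Thm. 3.5.1, p. 20) AFTER «replacing `T_f̃` by a different Galois stable
lattice if necessary, we assume that `φ|_{G_p} ≠ 𝟙`» (p. 17, §3.3: "one knows the Iwasawa Main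
Conjectures will be independent from the choice of a lattice"), with `μ(𝔛) = 0` for THAT lattice;
the crux quantifies over every curve `W` of the class, i.e. every lattice `T_pW`. The door needs
only the divisibility `Ch_Λ(X_ac)·R₀⟦T⟧ ⊆ (L)` (H3 = `SchneiderFree.BranchIMCDivAt`), and THIS half
is lattice-robust by pure Iwasawa algebra:
* §1 (`Λ = ℤ_p⟦T⟧`, any modules). A finitely generated `Λ`-module killed by `p^m` has
  `Ch = (p)^{μ}` (`charIdeal_eq_augIdealP_pow_of_smul_eq_zero`); hence for finitely generated
  torsion `X, X'` and a `Λ`-linear `φ : X → X'` with kernel and cokernel killed by `p^m`,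
  `(p)^a·Ch(X') = (p)^b·Ch(X)`, `a = μ(ker φ)`, `b = μ(coker φ)`
  (`augIdealP_pow_mul_charIdeal_eq_of_linearMap`: two short exact sequences and the tree's
  `Module.charIdeal_eq_mul_of_exact`). If `μ(X) = 0` — so `p ∤ f` for a generator `f` of `Ch(X)`
  (`not_C_dvd_of_muInvariant_eq_zero`) — then `Ch(X') = (p^k·f)`, `k = b − a ≥ 0`
  (`exists_charIdeal_eq_span_C_pow_mul`), whence `Ch(X') ⊆ Ch(X)`
  (`charIdeal_le_of_linearMap_of_muInvariant_eq_zero`, and `…'` for `φ : X' → X`).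
* §2 (the crux's objects). For two curves `W₁, W₂ /K` at one anticyclotomic frame `(κ, γ, 𝔭)`, a
  `Λ`-map between `X_ac^Σ(W₁[p^∞])` and `X_ac^Σ(W₂[p^∞])` (either direction) with `p`-power-killed
  kernel and cokernel and `μ(X_ac(W₁)) = 0` transports `Ch_Λ(X_ac(W₁))·R' ⊆ (L)` to `W₂` for the
  SAME `L` (`xac_charIdeal_map_le_transport`, `…'`), and `ord_p f_ac(0)` can only grow
  (`hasCharValuationAt_le_transport`).
What is NOT here: the comparison map between the Selmer duals of two isogenous curves (Galois
cohomology of the isogeny; not in the tree) and `μ = 0` itself (Keller–Yin's theorem for their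
lattice). The file turns the risk «lattice choice» into: ONE comparison map + KY's `μ = 0`.

References: Keller–Yin arXiv:2410.23241 §3.3 (p. 17), Thm. 3.5.1 (p. 20); Washington, *Cyclotomic
Fields* §13.2; Bourbaki AC VII §4.5; Neukirch–Schmidt–Wingberg V §3; Castella 2018 §2 (`X_ac`).
-/

noncomputable section

open scoped Classical

open NumberField IsDedekindDomain Field PowerSeries
  Literature.NumberTheory.EllipticCurves
  Literature.NumberTheory.EllipticCurves.IwasawaAlgebra
  Summit.BirchSwinnertonDyer.Rank1Residual.X11b.AcSelmer

set_option linter.dupNamespace false -- D-0017 layout: summit = sub-problem (mandated namespace)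
set_option autoImplicit false

namespace Summit.BirchSwinnertonDyer.BirchSwinnertonDyer.Theorems.SchneiderFree

/-! ## §1 Iwasawa algebra: characteristic ideals under `Λ`-maps with `p`-power-killed kernel and cokernel -/

section Lambda

variable {p : ℕ} [Fact p.Prime]

/-- A `Λ`-module killed by `p^m` is a torsion module (`p^m` is a non-zero-divisor of the domain `Λ`).
[folklore] -/
theorem isTorsion_of_C_pow_smul_eq_zero {N : Type*} [AddCommGroup N] [Module (IwasawaAlgebra p) N]
    (m : ℕ) (hN : ∀ x : N, (PowerSeries.C (p : ℤ_[p]) : IwasawaAlgebra p) ^ m • x = 0) :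
    Module.IsTorsion (IwasawaAlgebra p) N := fun x ↦
  ⟨⟨(PowerSeries.C (p : ℤ_[p]) : IwasawaAlgebra p) ^ m,
    mem_nonZeroDivisors_of_ne_zero (pow_ne_zero m (C_natCast_p_ne_zero p))⟩, hN x⟩

/-- **A height-one prime of `Λ` containing a power of `p` is `(p)`.** `(p)` is prime of height one
(`isPrime_augIdealP_holds`, `height_augIdealP_holds`), and two height-one primes in containment are
equal (`eq_of_height_eq_one_of_le`). [cite: Washington1997, §13.2] -/
theorem asIdeal_eq_augIdealP_of_C_pow_mem {𝔮 : PrimeSpectrum (IwasawaAlgebra p)}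
    (h𝔮 : 𝔮.asIdeal.height = 1) {m : ℕ}
    (hm : (PowerSeries.C (p : ℤ_[p]) : IwasawaAlgebra p) ^ m ∈ 𝔮.asIdeal) :
    𝔮.asIdeal = augIdealP p := by
  have hp : (PowerSeries.C (p : ℤ_[p]) : IwasawaAlgebra p) ∈ 𝔮.asIdeal :=
    𝔮.isPrime.mem_of_pow_mem m hm
  obtain ⟨𝔭₀, h𝔭₀⟩ : ∃ 𝔭₀ : PrimeSpectrum (IwasawaAlgebra p), 𝔭₀.asIdeal = augIdealP p :=
    ⟨⟨augIdealP p, isPrime_augIdealP_holds p⟩, rfl⟩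
  have hh : 𝔭₀.asIdeal.height = 1 := by rw [h𝔭₀]; exact height_augIdealP_holds p
  have hle : 𝔭₀.asIdeal ≤ 𝔮.asIdeal := by
    rw [h𝔭₀, augIdealP, Ideal.span_singleton_le_iff_mem]
    exact hp
  rw [← h𝔭₀, eq_of_height_eq_one_of_le hh h𝔮 hle]

/-- **`Ch_Λ(N) = (p)^{μ(N)}` for a finitely generated `Λ`-module killed by `p^m`.** Every
height-one prime `𝔮 ≠ (p)` misses `p^m`, so `N_𝔮 = 0` (`Module.lengthAt_eq_zero_of_isTorsionBy`) and
the finite product `∏ 𝔮^{ℓ_𝔮(N)}` (`charIdeal_eq_finsetProd`) collapses to its factor at `(p)`, whose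
exponent is `μ(N)` (`muInvariant_eq_toNat_lengthAt`). [cite: Washington1997, §13.2] -/
theorem charIdeal_eq_augIdealP_pow_of_smul_eq_zero (N : Type*) [AddCommGroup N]
    [Module (IwasawaAlgebra p) N] [Module.Finite (IwasawaAlgebra p) N] (m : ℕ)
    (hN : ∀ x : N, (PowerSeries.C (p : ℤ_[p]) : IwasawaAlgebra p) ^ m • x = 0) :
    Module.charIdeal (IwasawaAlgebra p) N = augIdealP p ^ muInvariant p N := by
  have htors : Module.IsTorsion (IwasawaAlgebra p) N := isTorsion_of_C_pow_smul_eq_zero m hN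
  have hsN : Module.IsTorsionBy (IwasawaAlgebra p) N
      ((PowerSeries.C (p : ℤ_[p]) : IwasawaAlgebra p) ^ m) := fun x ↦ hN x
  obtain ⟨𝔭₀, h𝔭₀⟩ : ∃ 𝔭₀ : PrimeSpectrum (IwasawaAlgebra p), 𝔭₀.asIdeal = augIdealP p :=
    ⟨⟨augIdealP p, isPrime_augIdealP_holds p⟩, rfl⟩
  have hh : 𝔭₀.asIdeal.height = 1 := by rw [h𝔭₀]; exact height_augIdealP_holds p
  have hμ : muInvariant p N = (Module.lengthAt (IwasawaAlgebra p) N 𝔭₀).toNat :=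
    muInvariant_eq_toNat_lengthAt p N 𝔭₀ h𝔭₀
  obtain ⟨S, hS1, hS0, hchar⟩ := charIdeal_eq_finsetProd p N htors
  -- every factor at a height-one prime other than `(p)` is trivial
  have hother : ∀ 𝔮 ∈ S, 𝔮 ≠ 𝔭₀ →
      𝔮.asIdeal ^ (Module.lengthAt (IwasawaAlgebra p) N 𝔮).toNat = 1 := by
    intro 𝔮 h𝔮S hne
    have hnot : (PowerSeries.C (p : ℤ_[p]) : IwasawaAlgebra p) ^ m ∉ 𝔮.asIdeal := by
      intro hmem
      exact hne (PrimeSpectrum.ext ((asIdeal_eq_augIdealP_of_C_pow_mem (hS1 𝔮 h𝔮S) hmem).trans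
        h𝔭₀.symm))
    rw [Module.lengthAt_eq_zero_of_isTorsionBy hsN 𝔮 hnot]
    simp
  rw [hchar, hμ, ← h𝔭₀]
  by_cases hmem : 𝔭₀ ∈ S
  · rw [Finset.prod_eq_single_of_mem 𝔭₀ hmem (fun 𝔮 h𝔮 hne ↦ hother 𝔮 h𝔮 hne)]
  · rw [Finset.prod_eq_one (fun 𝔮 h𝔮 ↦ hother 𝔮 h𝔮 (fun h ↦ hmem (h ▸ h𝔮))), hS0 𝔭₀ hh hmem]
    simp

/-- **`(p)^a · Ch_Λ(X') = (p)^b · Ch_Λ(X)`** for finitely generated torsion `Λ`-modules `X, X'` and a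
`Λ`-linear map `φ : X → X'` whose kernel and cokernel are killed by `p^m`, with `a = μ(ker φ)` and
`b = μ(coker φ)`: multiplicativity of `Ch_Λ` in `0 → ker φ → X → im φ → 0` and
`0 → im φ → X' → coker φ → 0` (`Module.charIdeal_eq_mul_of_exact`) and
`charIdeal_eq_augIdealP_pow_of_smul_eq_zero` for the two outer terms.
[cite: NeukirchSchmidtWingberg2008, Ch. V §3, Remark 2 after (5.3.9)] [cite: Washington1997, §13.2] -/
theorem augIdealP_pow_mul_charIdeal_eq_of_linearMap {X X' : Type*} [AddCommGroup X]
    [Module (IwasawaAlgebra p) X] [AddCommGroup X'] [Module (IwasawaAlgebra p) X']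
    [Module.Finite (IwasawaAlgebra p) X] [Module.Finite (IwasawaAlgebra p) X']
    (hX : Module.IsTorsion (IwasawaAlgebra p) X) (hX' : Module.IsTorsion (IwasawaAlgebra p) X')
    (φ : X →ₗ[IwasawaAlgebra p] X') (m : ℕ)
    (hker : ∀ x : X, φ x = 0 → (PowerSeries.C (p : ℤ_[p]) : IwasawaAlgebra p) ^ m • x = 0)
    (hcoker : ∀ y : X', ∃ x : X, (PowerSeries.C (p : ℤ_[p]) : IwasawaAlgebra p) ^ m • y = φ x) :
    augIdealP p ^ muInvariant p (LinearMap.ker φ) * Module.charIdeal (IwasawaAlgebra p) X' =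
      augIdealP p ^ muInvariant p (X' ⧸ LinearMap.range φ) *
        Module.charIdeal (IwasawaAlgebra p) X := by
  haveI : IsNoetherian (IwasawaAlgebra p) X := isNoetherian_of_isNoetherianRing_of_finite _ _
  haveI : IsNoetherian (IwasawaAlgebra p) X' := isNoetherian_of_isNoetherianRing_of_finite _ _
  -- the two outer terms are killed by `p^m`
  have hK : ∀ x : LinearMap.ker φ, (PowerSeries.C (p : ℤ_[p]) : IwasawaAlgebra p) ^ m • x = 0 := by
    intro x
    apply Subtype.ext
    rw [Submodule.coe_smul, Submodule.coe_zero]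
    exact hker x (LinearMap.mem_ker.mp x.2)
  have hC : ∀ y : X' ⧸ LinearMap.range φ,
      (PowerSeries.C (p : ℤ_[p]) : IwasawaAlgebra p) ^ m • y = 0 := by
    intro y
    induction y using Submodule.Quotient.induction_on with
    | H y =>
      obtain ⟨x, hx⟩ := hcoker y
      rw [← Submodule.Quotient.mk_smul, hx, Submodule.Quotient.mk_eq_zero]
      exact LinearMap.mem_range_self φ x
  have hcharK := charIdeal_eq_augIdealP_pow_of_smul_eq_zero (LinearMap.ker φ) m hK
  have hcharC := charIdeal_eq_augIdealP_pow_of_smul_eq_zero (X' ⧸ LinearMap.range φ) m hC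
  -- `0 → ker φ → X → im φ → 0`
  have hex1 : Function.Exact (LinearMap.ker φ).subtype φ.rangeRestrict :=
    LinearMap.exact_iff.mpr (by rw [LinearMap.ker_rangeRestrict, Submodule.range_subtype])
  have h1 := Module.charIdeal_eq_mul_of_exact hX (LinearMap.ker φ).subtype φ.rangeRestrict
    (Submodule.injective_subtype _) (LinearMap.surjective_rangeRestrict φ) hex1
  -- `0 → im φ → X' → coker φ → 0`
  have h2 := Module.charIdeal_eq_mul_of_exact hX' (LinearMap.range φ).subtype
    (LinearMap.range φ).mkQ (Submodule.injective_subtype _) (Submodule.mkQ_surjective _)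
    (LinearMap.exact_subtype_mkQ _)
  rw [h1, h2, hcharK, hcharC]
  ring

/-- **Characteristic ideals of `Λ`-modules are principal** (the tree's `charIdeal_isPrincipal_holds`),
in the form "`Ch_Λ(X) = (f)` for some `f`". [cite: Washington1997, §13.2] -/
theorem exists_charIdeal_eq_span (X : Type*) [AddCommGroup X] [Module (IwasawaAlgebra p) X] :
    ∃ f : IwasawaAlgebra p, Module.charIdeal (IwasawaAlgebra p) X = Ideal.span {f} := by
  haveI : (Module.charIdeal (IwasawaAlgebra p) X).IsPrincipal := charIdeal_isPrincipal_holds p X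
  exact ⟨_, (Ideal.span_singleton_generator _).symm⟩

/-- **`μ(X) = 0` ⇒ `p ∤ f` for a generator `f` of `Ch_Λ(X)`** (`X` finitely generated torsion): were
`p ∣ f`, the honest finite product `Ch_Λ(X) = ∏ 𝔮^{ℓ_𝔮(X)}` would lie in the prime `(p)`, so some
factor `𝔮^{ℓ_𝔮(X)}` with `ℓ_𝔮(X) ≠ 0` would, forcing `𝔮 = (p)` and `μ(X) = ℓ_{(p)}(X) ≠ 0`.
[cite: Washington1997, §13.2] -/
theorem not_C_dvd_of_muInvariant_eq_zero {X : Type*} [AddCommGroup X] [Module (IwasawaAlgebra p) X]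
    [Module.Finite (IwasawaAlgebra p) X] (hX : Module.IsTorsion (IwasawaAlgebra p) X)
    (hμ : muInvariant p X = 0) {f : IwasawaAlgebra p}
    (hf : Module.charIdeal (IwasawaAlgebra p) X = Ideal.span {f}) :
    ¬ (PowerSeries.C (p : ℤ_[p]) : IwasawaAlgebra p) ∣ f := by
  intro hdvd
  obtain ⟨𝔭₀, h𝔭₀⟩ : ∃ 𝔭₀ : PrimeSpectrum (IwasawaAlgebra p), 𝔭₀.asIdeal = augIdealP p :=
    ⟨⟨augIdealP p, isPrime_augIdealP_holds p⟩, rfl⟩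
  have hh : 𝔭₀.asIdeal.height = 1 := by rw [h𝔭₀]; exact height_augIdealP_holds p
  have hμ' : (Module.lengthAt (IwasawaAlgebra p) X 𝔭₀).toNat = 0 := by
    rw [← muInvariant_eq_toNat_lengthAt p X 𝔭₀ h𝔭₀, hμ]
  obtain ⟨S, hS1, hS0, hchar⟩ := charIdeal_eq_finsetProd p X hX
  have hle : Module.charIdeal (IwasawaAlgebra p) X ≤ 𝔭₀.asIdeal := by
    rw [hf, Ideal.span_singleton_le_iff_mem, h𝔭₀, augIdealP, Ideal.mem_span_singleton]
    exact hdvd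
  rw [hchar] at hle
  obtain ⟨𝔮, h𝔮S, h𝔮le⟩ := 𝔭₀.isPrime.prod_le.mp hle
  -- the factor at `𝔮` is a genuine power (exponent ≠ 0), and `𝔮 ≤ (p)` forces `𝔮 = (p)`
  have hn : (Module.lengthAt (IwasawaAlgebra p) X 𝔮).toNat ≠ 0 := by
    intro h0
    rw [h0, pow_zero, Ideal.one_eq_top, top_le_iff] at h𝔮le
    exact 𝔭₀.isPrime.ne_top h𝔮le
  have h𝔮𝔭 : 𝔮 = 𝔭₀ :=
    eq_of_height_eq_one_of_le (hS1 𝔮 h𝔮S) hh (Ideal.IsPrime.le_of_pow_le h𝔮le)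
  rw [h𝔮𝔭] at hn
  exact hn hμ'

/-- **`μ(X) = 0` transport of a generator.** For finitely generated torsion `X, X'`, a `Λ`-linear
`φ : X → X'` with kernel and cokernel killed by `p^m`, and a generator `f` of `Ch_Λ(X)` with `p ∤ f`:
`Ch_Λ(X') = (p^k · f)` for some `k` (namely `k = μ(coker φ) − μ(ker φ) ≥ 0`). From
`(p^a f') = (p^b f)` in the domain `Λ`: `p^a f' u = p^b f` for a unit `u`; `b < a` would give `p ∣ f`.
[cite: Washington1997, §13.2] -/
theorem exists_charIdeal_eq_span_C_pow_mul {X X' : Type*} [AddCommGroup X]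
    [Module (IwasawaAlgebra p) X] [AddCommGroup X'] [Module (IwasawaAlgebra p) X']
    [Module.Finite (IwasawaAlgebra p) X] [Module.Finite (IwasawaAlgebra p) X']
    (hX : Module.IsTorsion (IwasawaAlgebra p) X) (hX' : Module.IsTorsion (IwasawaAlgebra p) X')
    (φ : X →ₗ[IwasawaAlgebra p] X') (m : ℕ)
    (hker : ∀ x : X, φ x = 0 → (PowerSeries.C (p : ℤ_[p]) : IwasawaAlgebra p) ^ m • x = 0)
    (hcoker : ∀ y : X', ∃ x : X, (PowerSeries.C (p : ℤ_[p]) : IwasawaAlgebra p) ^ m • y = φ x)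
    {f : IwasawaAlgebra p} (hf : Module.charIdeal (IwasawaAlgebra p) X = Ideal.span {f})
    (hμ : ¬ (PowerSeries.C (p : ℤ_[p]) : IwasawaAlgebra p) ∣ f) :
    ∃ k : ℕ, Module.charIdeal (IwasawaAlgebra p) X' =
      Ideal.span {(PowerSeries.C (p : ℤ_[p]) : IwasawaAlgebra p) ^ k * f} := by
  set c : IwasawaAlgebra p := PowerSeries.C (p : ℤ_[p]) with hc
  obtain ⟨f', hf'⟩ := exists_charIdeal_eq_span (p := p) X'
  have h := augIdealP_pow_mul_charIdeal_eq_of_linearMap hX hX' φ m hker hcoker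
  set a := muInvariant p (LinearMap.ker φ) with ha
  set b := muInvariant p (X' ⧸ LinearMap.range φ) with hb
  rw [hf, hf', augIdealP, Ideal.span_singleton_pow, Ideal.span_singleton_pow,
    Ideal.span_singleton_mul_span_singleton, Ideal.span_singleton_mul_span_singleton,
    Ideal.span_singleton_eq_span_singleton] at h
  obtain ⟨u, hu⟩ := h
  rcases le_or_gt a b with hab | hba
  · refine ⟨b - a, ?_⟩
    rw [hf', Ideal.span_singleton_eq_span_singleton]
    refine ⟨u, mul_left_cancel₀ (pow_ne_zero a (C_natCast_p_ne_zero p)) ?_⟩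
    rw [← hc, ← mul_assoc, hu, ← mul_assoc, ← pow_add, Nat.add_sub_cancel' hab]
  · exfalso
    apply hμ
    refine ⟨c ^ (a - b - 1) * f' * u, mul_left_cancel₀ (pow_ne_zero b (C_natCast_p_ne_zero p)) ?_⟩
    rw [← hc, ← hu]
    have hab : a = b + 1 + (a - b - 1) := by omega
    conv_lhs => rw [hab]
    ring

/-- **`μ(X) = 0` ⇒ `Ch_Λ(X') ⊆ Ch_Λ(X)`** whenever a `Λ`-linear `φ : X → X'` has `p`-power-killed
kernel and cokernel (`X, X'` finitely generated torsion). [cite: Washington1997, §13.2] -/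
theorem charIdeal_le_of_linearMap_of_muInvariant_eq_zero {X X' : Type*} [AddCommGroup X]
    [Module (IwasawaAlgebra p) X] [AddCommGroup X'] [Module (IwasawaAlgebra p) X']
    [Module.Finite (IwasawaAlgebra p) X] [Module.Finite (IwasawaAlgebra p) X']
    (hX : Module.IsTorsion (IwasawaAlgebra p) X) (hX' : Module.IsTorsion (IwasawaAlgebra p) X')
    (hμ : muInvariant p X = 0) (φ : X →ₗ[IwasawaAlgebra p] X') (m : ℕ)
    (hker : ∀ x : X, φ x = 0 → (PowerSeries.C (p : ℤ_[p]) : IwasawaAlgebra p) ^ m • x = 0)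
    (hcoker : ∀ y : X', ∃ x : X, (PowerSeries.C (p : ℤ_[p]) : IwasawaAlgebra p) ^ m • y = φ x) :
    Module.charIdeal (IwasawaAlgebra p) X' ≤ Module.charIdeal (IwasawaAlgebra p) X := by
  obtain ⟨f, hf⟩ := exists_charIdeal_eq_span (p := p) X
  obtain ⟨k, hk⟩ := exists_charIdeal_eq_span_C_pow_mul hX hX' φ m hker hcoker hf
    (not_C_dvd_of_muInvariant_eq_zero hX hμ hf)
  rw [hk, hf, Ideal.span_singleton_le_span_singleton]
  exact dvd_mul_left f _

/-- **`μ(X) = 0` ⇒ `Ch_Λ(X') ⊆ Ch_Λ(X)`, map in the OTHER direction** (`φ : X' → X` with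
`p`-power-killed kernel and cokernel): the relation `(p)^a Ch(X) = (p)^b Ch(X')` is symmetric in shape,
and `p ∤ f` for the generator of `Ch(X)` again forces `Ch(X') = (p^k f)`.
[cite: Washington1997, §13.2] -/
theorem charIdeal_le_of_linearMap_of_muInvariant_eq_zero' {X X' : Type*} [AddCommGroup X]
    [Module (IwasawaAlgebra p) X] [AddCommGroup X'] [Module (IwasawaAlgebra p) X']
    [Module.Finite (IwasawaAlgebra p) X] [Module.Finite (IwasawaAlgebra p) X']
    (hX : Module.IsTorsion (IwasawaAlgebra p) X) (hX' : Module.IsTorsion (IwasawaAlgebra p) X')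
    (hμ : muInvariant p X = 0) (ψ : X' →ₗ[IwasawaAlgebra p] X) (m : ℕ)
    (hker : ∀ y : X', ψ y = 0 → (PowerSeries.C (p : ℤ_[p]) : IwasawaAlgebra p) ^ m • y = 0)
    (hcoker : ∀ x : X, ∃ y : X', (PowerSeries.C (p : ℤ_[p]) : IwasawaAlgebra p) ^ m • x = ψ y) :
    Module.charIdeal (IwasawaAlgebra p) X' ≤ Module.charIdeal (IwasawaAlgebra p) X := by
  set c : IwasawaAlgebra p := PowerSeries.C (p : ℤ_[p]) with hc
  obtain ⟨f, hf⟩ := exists_charIdeal_eq_span (p := p) X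
  obtain ⟨f', hf'⟩ := exists_charIdeal_eq_span (p := p) X'
  have hμf := not_C_dvd_of_muInvariant_eq_zero hX hμ hf
  have h := augIdealP_pow_mul_charIdeal_eq_of_linearMap hX' hX ψ m hker hcoker
  set a := muInvariant p (LinearMap.ker ψ) with ha
  set b := muInvariant p (X ⧸ LinearMap.range ψ) with hb
  -- `h : (c)^a · (f) = (c)^b · (f')`
  rw [hf, hf', augIdealP, Ideal.span_singleton_pow, Ideal.span_singleton_pow,
    Ideal.span_singleton_mul_span_singleton, Ideal.span_singleton_mul_span_singleton,
    Ideal.span_singleton_eq_span_singleton] at h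
  obtain ⟨u, hu⟩ := h
  rw [← hc] at hu
  rw [hf, hf', Ideal.span_singleton_le_span_singleton]
  rcases le_or_gt b a with hba | hab
  · -- `f' = c^{a-b} f u`
    obtain ⟨d, hd⟩ : ∃ d, a = b + d := ⟨a - b, by omega⟩
    refine ⟨c ^ d * u, mul_left_cancel₀ (pow_ne_zero b (C_natCast_p_ne_zero p)) ?_⟩
    rw [← hc, ← hu, hd, pow_add]
    ring
  · exfalso
    apply hμf
    -- `c^a f u = c^b f'` with `b > a` gives `f = c · (c^{b-a-1} f' u⁻¹)`
    obtain ⟨e, he⟩ : ∃ e, b = a + 1 + e := ⟨b - a - 1, by omega⟩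
    refine ⟨c ^ e * f' * ↑u⁻¹, mul_left_cancel₀ (pow_ne_zero a (C_natCast_p_ne_zero p)) ?_⟩
    have hu' : c ^ a * f = c ^ b * f' * ↑u⁻¹ := by
      rw [← hu, Units.mul_inv_cancel_right]
    rw [← hc, hu', he, pow_add, pow_succ]
    ring

end Lambda

/-! ## §2 The crux's objects: H3 and `ord_p f_ac(0)` are lattice-robust given a comparison map and `μ = 0` -/

section Door

universe u

variable {K : Type u} [Field K] [NumberField K] {p : ℕ} [Fact p.Prime]
  (W₁ W₂ : WeierstrassCurve K) (κ : ZpExtension K p) (𝔭 : HeightOneSpectrum (𝓞 K))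
  (S : Set (HeightOneSpectrum (𝓞 K))) (γ : Field.absoluteGaloisGroup K) [Fact (κ.IsTopGenerator γ)]

/-- **H3 is lattice-robust (comparison map `X_ac(W₁) → X_ac(W₂)`).** If the anticyclotomic Selmer duals
`X_ac^Σ(W₁[p^∞])`, `X_ac^Σ(W₂[p^∞])` at one frame `(κ, γ, 𝔭)` are finitely generated torsion, related by
a `Λ`-linear map with `p`-power-killed kernel and cokernel, and `μ(X_ac(W₁)) = 0`, then the door
divisibility `Ch_Λ(X_ac(W₁))·R' ⊆ (L)` along ANY ring map `e : Λ → R'` (for the crux: `R' = R₀⟦T⟧`,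
`e` the base change `toUnr`) passes to `W₂` with the SAME `L`. Reading: Keller–Yin's equality for
their lattice (with `μ = 0`, Thm. 3.5.1) gives H3 for every curve of the isogeny class once the
comparison map is supplied. CONDITIONAL on the listed hypotheses; nothing asserted about curves.
[cite: KellerYin2024b, §3.3 (arXiv:2410.23241 p. 17) and Thm. 3.5.1 (p. 20) (shape only; preprint)]
[cite: Washington1997, §13.2] -/
theorem xac_charIdeal_map_le_transport
    [Module.Finite (IwasawaAlgebra p) (XAc W₁ p κ 𝔭 S γ)]
    [Module.Finite (IwasawaAlgebra p) (XAc W₂ p κ 𝔭 S γ)]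
    (h₁ : Module.IsTorsion (IwasawaAlgebra p) (XAc W₁ p κ 𝔭 S γ))
    (h₂ : Module.IsTorsion (IwasawaAlgebra p) (XAc W₂ p κ 𝔭 S γ))
    (hμ : muInvariant p (XAc W₁ p κ 𝔭 S γ) = 0)
    (φ : XAc W₁ p κ 𝔭 S γ →ₗ[IwasawaAlgebra p] XAc W₂ p κ 𝔭 S γ) (m : ℕ)
    (hker : ∀ x, φ x = 0 → (PowerSeries.C (p : ℤ_[p]) : IwasawaAlgebra p) ^ m • x = 0)
    (hcoker : ∀ y, ∃ x, (PowerSeries.C (p : ℤ_[p]) : IwasawaAlgebra p) ^ m • y = φ x)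
    {R' : Type*} [CommRing R'] (e : IwasawaAlgebra p →+* R') {L : R'}
    (hdiv : (XAc.charIdeal W₁ p κ 𝔭 S γ).map e ≤ Ideal.span {L}) :
    (XAc.charIdeal W₂ p κ 𝔭 S γ).map e ≤ Ideal.span {L} :=
  (Ideal.map_mono (charIdeal_le_of_linearMap_of_muInvariant_eq_zero h₁ h₂ hμ φ m hker hcoker)).trans
    hdiv

/-- **H3 is lattice-robust (comparison map `X_ac(W₂) → X_ac(W₁)`)** — the same with the comparison map
in the other direction (for an isogeny `W₁ → W₂` the natural map on Pontryagin duals goes from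
`X_ac(W₂)` to `X_ac(W₁)`). CONDITIONAL; nothing asserted about curves.
[cite: KellerYin2024b, §3.3 (arXiv:2410.23241 p. 17) (shape only; preprint)] [cite: Washington1997, §13.2] -/
theorem xac_charIdeal_map_le_transport'
    [Module.Finite (IwasawaAlgebra p) (XAc W₁ p κ 𝔭 S γ)]
    [Module.Finite (IwasawaAlgebra p) (XAc W₂ p κ 𝔭 S γ)]
    (h₁ : Module.IsTorsion (IwasawaAlgebra p) (XAc W₁ p κ 𝔭 S γ))
    (h₂ : Module.IsTorsion (IwasawaAlgebra p) (XAc W₂ p κ 𝔭 S γ))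
    (hμ : muInvariant p (XAc W₁ p κ 𝔭 S γ) = 0)
    (ψ : XAc W₂ p κ 𝔭 S γ →ₗ[IwasawaAlgebra p] XAc W₁ p κ 𝔭 S γ) (m : ℕ)
    (hker : ∀ y, ψ y = 0 → (PowerSeries.C (p : ℤ_[p]) : IwasawaAlgebra p) ^ m • y = 0)
    (hcoker : ∀ x, ∃ y, (PowerSeries.C (p : ℤ_[p]) : IwasawaAlgebra p) ^ m • x = ψ y)
    {R' : Type*} [CommRing R'] (e : IwasawaAlgebra p →+* R') {L : R'}
    (hdiv : (XAc.charIdeal W₁ p κ 𝔭 S γ).map e ≤ Ideal.span {L}) :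
    (XAc.charIdeal W₂ p κ 𝔭 S γ).map e ≤ Ideal.span {L} :=
  (Ideal.map_mono (charIdeal_le_of_linearMap_of_muInvariant_eq_zero' h₁ h₂ hμ ψ m hker hcoker)).trans
    hdiv

/-- **`ord_p f_ac(0)` can only grow along a `p`-power comparison from a `μ = 0` lattice**: with the data
of `xac_charIdeal_map_le_transport`, `HasCharValuationAt W₁ n₁` and `HasCharValuationAt W₂ n₂` force
`n₁ ≤ n₂` (`Ch(X₂) = (p^k f₁)`, `ord_p (p^k f₁)(0) = k + ord_p f₁(0)`). So the control value of a
second lattice never undercuts the divisibility read on Keller–Yin's. CONDITIONAL; nothing asserted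
about curves. [cite: Castella2018, Thm. 2.3 (arXiv:1704.06608 p. 5) (shape only)] [cite: Washington1997, §13.2] -/
theorem hasCharValuationAt_le_transport
    [Module.Finite (IwasawaAlgebra p) (XAc W₁ p κ 𝔭 S γ)]
    [Module.Finite (IwasawaAlgebra p) (XAc W₂ p κ 𝔭 S γ)]
    (hμ : muInvariant p (XAc W₁ p κ 𝔭 S γ) = 0)
    (φ : XAc W₁ p κ 𝔭 S γ →ₗ[IwasawaAlgebra p] XAc W₂ p κ 𝔭 S γ) (m : ℕ)
    (hker : ∀ x, φ x = 0 → (PowerSeries.C (p : ℤ_[p]) : IwasawaAlgebra p) ^ m • x = 0)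
    (hcoker : ∀ y, ∃ x, (PowerSeries.C (p : ℤ_[p]) : IwasawaAlgebra p) ^ m • y = φ x)
    {n₁ n₂ : ℕ} (hn₁ : XAc.HasCharValuationAt W₁ p κ 𝔭 S γ n₁)
    (hn₂ : XAc.HasCharValuationAt W₂ p κ 𝔭 S γ n₂) : n₁ ≤ n₂ := by
  obtain ⟨h₁, f₁, hf₁, hf₁0, hv₁⟩ := hn₁
  obtain ⟨h₂, f₂, hf₂, hf₂0, hv₂⟩ := hn₂
  obtain ⟨k, hk⟩ := exists_charIdeal_eq_span_C_pow_mul h₁ h₂ φ m hker hcoker hf₁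
    (not_C_dvd_of_muInvariant_eq_zero h₁ hμ hf₁)
  -- `Ch(X₂) = (f₂) = (p^k f₁)`: compare constant terms
  have hgen : Ideal.span ({f₂} : Set (IwasawaAlgebra p)) =
      Ideal.span {(PowerSeries.C (p : ℤ_[p]) : IwasawaAlgebra p) ^ k * f₁} := hf₂.symm.trans hk
  obtain ⟨_, hval⟩ := valuation_constantCoeff_eq_of_span_singleton_eq hgen hf₂0
  have hck : PowerSeries.constantCoeff ((PowerSeries.C (p : ℤ_[p]) : IwasawaAlgebra p) ^ k * f₁) =
      (p : ℤ_[p]) ^ k * PowerSeries.constantCoeff f₁ := by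
    rw [map_mul, map_pow, PowerSeries.constantCoeff_C]
  rw [hck, PadicInt.valuation_p_pow_mul k _ hf₁0, hv₁, hv₂] at hval
  -- `hval : k + n₁ = n₂` in `ℕ` (valuations of `ℤ_p` are natural numbers)
  omega

end Door

end Summit.BirchSwinnertonDyer.BirchSwinnertonDyer.Theorems.SchneiderFree

end
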